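import Summits.BirchSwinnertonDyer.BirchSwinnertonDyer.Theses.EisensteinDepletionAtTwo
import Literature.NumberTheory.EllipticCurves.IsogenyFrobeniusTraceHoldsProofs
import Literature.NumberTheory.EllipticCurves.EichlerShimuraConstruction
import Literature.NumberTheory.EllipticCurves.ShimuraSubgroupHeckeCongruence
import Summits.BirchSwinnertonDyer.BirchSwinnertonDyer.Theorems.EisensteinDepletionAtTwoStarOptBNSFStubLevelDetect
import Summits.BirchSwinnertonDyer.BirchSwinnertonDyer.Theorems.EisensteinDepletionAtTwoStarOptBNSFStubIsogenyFactor
import Summits.BirchSwinnertonDyer.BirchSwinnertonDyer.Theorems.EisensteinDepletionAtTwoStarOptBNSFStubOddIsoArch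
import Summits.BirchSwinnertonDyer.BirchSwinnertonDyer.Theorems.EisensteinDepletionAtTwoStarOptBNSFStubTwoPowerWalk
import Summits.BirchSwinnertonDyer.BirchSwinnertonDyer.Theorems.EisensteinDepletionAtTwoStarOptBNSFStubOddIsoTwoAdic
import Summits.BirchSwinnertonDyer.BirchSwinnertonDyer.Theorems.EisensteinDepletionAtTwoStarOptBTwoTorsionOfIsogenous
import Summits.BirchSwinnertonDyer.BirchSwinnertonDyer.Theorems.EisensteinDepletionAtTwoStarOptBNSFTwoAdicDictionary
import Summits.BirchSwinnertonDyer.BirchSwinnertonDyer.Theorems.ByReductionTypeAtTwoOrdIsogenyRescale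
import Summits.BirchSwinnertonDyer.BirchSwinnertonDyer.Theorems.EisensteinDepletionAtTwoStarOptBNSFOddShimuraCover
import Summits.BirchSwinnertonDyer.BirchSwinnertonDyer.Theorems.EisensteinDepletionAtTwoStarOptBNSFStevensAtTwoOfPE0
import Summits.BirchSwinnertonDyer.BirchSwinnertonDyer.Theorems.EisensteinDepletionAtTwoStarOptBNSFX1OptimalOfModularity
import Summits.BirchSwinnertonDyer.BirchSwinnertonDyer.Theorems.EisensteinDepletionAtTwoStarOptBNSFCongruenceCore
import Summits.BirchSwinnertonDyer.BirchSwinnertonDyer.Theorems.EisensteinDepletionAtTwoStarOptBNSFParityGroup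
import Literature.NumberTheory.EllipticCurves.TwoTorsionHalfPeriodProofs
import Summits.BirchSwinnertonDyer.BirchSwinnertonDyer.Theorems.EisensteinDepletionAtTwoStarOptBNSFFormalSqrtAtTwo
import Summits.BirchSwinnertonDyer.BirchSwinnertonDyer.Theorems.EisensteinDepletionAtTwoStarOptBNSFGamma1Bounded
import Summits.BirchSwinnertonDyer.BirchSwinnertonDyer.Theorems.EisensteinDepletionAtTwoStarOptBNSFParamIntegral
import Summits.BirchSwinnertonDyer.BirchSwinnertonDyer.Theorems.EisensteinDepletionAtTwoStarOptBNSFParamExpansion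
import Summits.BirchSwinnertonDyer.BirchSwinnertonDyer.Theorems.EisensteinDepletionAtTwoStarOptBNSFKummerAlg
import Summits.BirchSwinnertonDyer.BirchSwinnertonDyer.Theorems.EisensteinDepletionAtTwoStarOptBNSFKummerQExp
import Summits.BirchSwinnertonDyer.BirchSwinnertonDyer.Theorems.EisensteinDepletionAtTwoStarOptBNSFKummerFn
import Summits.BirchSwinnertonDyer.BirchSwinnertonDyer.Theorems.EisensteinDepletionAtTwoStarOptBNSFKummerForm
import Summits.BirchSwinnertonDyer.BirchSwinnertonDyer.Theorems.EisensteinDepletionAtTwoStarOptBNSFX1Denominator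
import Summits.BirchSwinnertonDyer.BirchSwinnertonDyer.Theorems.EisensteinDepletionAtTwoStarOptBNSFNsfDoorStevens
import Summits.BirchSwinnertonDyer.BirchSwinnertonDyer.Theorems.EisensteinDepletionAtTwoStarOptBNSFNsfReduction
import HarnessLib

/-!
# Line `nsf`, end state II: `StarOptBNSF` modulo the three print named facts (crux `StarOptBNSF`, stmt-BirchSwinnertonDyer-27047)

Lead star-p1 GEN 12.  Distillation of the registered skeleton `Cruxes/StarOptBNSF/Lines/nsf` v22, part 2 of 2 (regime transport is the tree's
`…NsfReduction.regimeTransport`): the `X₁(N)`-optimal datum with integer Manin constant from Modularity + CES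
(`x1OptimalInt_of_print`), P-E₀ in ordinary form (`pE0_ord`), and the crux statement
`Summit.BirchSwinnertonDyer.BirchSwinnertonDyer.Theses.EisensteinDepletionAtTwo.StarOptBNSF` from
`exists_isNewformOf`, `exists_optimal_gamma1ParametrizationData` and `CalegariDimitrovTang2025_unboundedDenominators`
(`starOptBNSF_of_print`).  CONDITIONAL (three named print facts); no `sorry`, no new definition; nothing here reads `r_an`;
BSD is not proved by this file.
-/

set_option linter.dupNamespace false
set_option autoImplicit false

noncomputable section

namespace Summit.BirchSwinnertonDyer.BirchSwinnertonDyer.Theorems.DepletionAtTwo.NsfDoorPrint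

open scoped MatrixGroups ModularForm
open Literature.NumberTheory.EllipticCurves
open Literature.NumberTheory.EllipticCurves.Greenberg1999
open Literature.NumberTheory.EllipticCurves.ModularForms
open Summit.BirchSwinnertonDyer.BirchSwinnertonDyer.Theorems.DepletionAtTwo

/-- **The `X₁(N)`-optimal datum with INTEGER Manin constant, from the two print named facts** Modularity (`exists_isNewformOf`) and
the CES/Stevens optimal `Γ₁(N)`-parametrisation datum (`exists_optimal_gamma1ParametrizationData`) — the skeleton's
`x1OptimalInt_of_print`, verbatim. [cite: ConradEdixhovenStein2003, §6.1 Lemma 6.1.6] [cite: Stevens1989, Thm. 1.6] [cite: BCDTJAMS2001, Thm. A] -/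
theorem x1OptimalInt_of_print (hnf : exists_isNewformOf) (hex : exists_optimal_gamma1ParametrizationData) :
    ∀ (W₀ : WeierstrassCurve ℚ) [W₀.IsElliptic]
      ⦃N : ℕ⦄ [NeZero N] (f : CuspForm (CongruenceSubgroup.Gamma0 N) 2), IsNewformOf W₀ f →
      ∃ (W₁ : WeierstrassCurve ℚ) (_ : W₁.IsElliptic) (_ : W₁.IsGloballyMinimal) (L₁ : PeriodPair) (c₁ : ℚ),
        IsNewformOf W₁ f ∧ IsNeronLatticeOf (W₁.baseChange ℂ) L₁ ∧ c₁ ≠ 0 ∧ (∃ m : ℤ, (m : ℚ) = c₁) ∧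
          (∀ z ∈ periodLatticeGamma1 f, (c₁ : ℂ) * z ∈ L₁.lattice) ∧
          (∀ z ∈ L₁.lattice, ∃ w ∈ periodLatticeGamma1 f, z = (c₁ : ℂ) * w) := by
  intro W₀ _ N _ f hW₀
  -- a global minimal model `C • W₀` of the given curve (same newform)
  obtain ⟨C, hC⟩ := WeierstrassCurve.hasGlobalMinimalModel_rat_holds W₀
  haveI := hC
  have hW₀' : IsNewformOf (C • W₀) f :=
    hW₀.of_isIsogenous (WeierstrassCurve.isIsogenous_of_smul W₀ C)
  -- the level is the conductor (Modularity + strong multiplicity one)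
  have hN : N = (C • W₀).conductorNorm ℤ :=
    IsNewformOf.level_eq_conductorNorm_of_exists_isNewformOf hnf hW₀'
  -- the strong Weil curve `W₂` of the class with its lattice-optimal `X₀(N)`-datum `D₀`
  obtain ⟨W₂, hE₂, hM₂, D₀, hfD₀, hiso₂, hmin⟩ :=
    Literature.NumberTheory.Automorphic.exists_optimal_modularParametrizationData_of_modularity hnf N (C • W₀) hN.symm
  haveI := hE₂
  haveI := hM₂
  have h₀ : ∀ z ∈ D₀.L.lattice, ∃ w ∈ periodLattice D₀.f, z = D₀.c * w :=
    D₀.latticeEq_of_forall_modularDegree_le hmin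
  -- Stevens' `X₁(N)`-optimal curve `W₁` of the class with its optimal datum `D₁`
  obtain ⟨W₁, i₁, i₂, D₁, hiso₁, hopt⟩ := hex W₂ D₀ h₀
  have hW₂ : IsNewformOf W₂ f := hW₀'.of_isIsogenous hiso₂.symm_of_charZero
  have hW₁ : IsNewformOf W₁ f := hW₂.of_isIsogenous hiso₁
  have hD₁f : D₁.f = f := D₁.isNewformOf.unique hW₁
  have hc₁ : (D₁.c : ℚ) ≠ 0 := by exact_mod_cast D₁.maninConstant_ne_zero
  refine ⟨W₁, i₁, i₂, D₁.L, (D₁.c : ℚ), hW₁, D₁.isNeronLattice, hc₁, ⟨D₁.c, rfl⟩, ?_, ?_⟩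
  · intro z hz
    have h := D₁.smul_periodLatticeGamma1_le z (hD₁f ▸ hz)
    push_cast
    exact h
  · intro z hz
    obtain ⟨w, hw, hzw⟩ := hopt z hz
    refine ⟨w, hD₁f ▸ hw, ?_⟩
    push_cast
    exact hzw

/-- **P-E₀ (ordinary form) modulo print**: the `X₀(N)`-lattice-optimal globally minimal `W₀` of a class at an odd level with a
traceless prime, good ordinary at `2`, has no FORMAL rational 2-torsion point — «Stevens at 2» for `W₁` (`NsfDoor.stevensAtTwoX1Int`)
transported along the odd Shimura cover (`…ShimuraCover.not_exists_ramified_of_gamma1Optimal`). [cite: Stevens1989, §2] -/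
theorem pE0_ord (hUBD : Literature.NumberTheory.Automorphic.CalegariDimitrovTang2025_unboundedDenominators)
    (hnf : exists_isNewformOf) (hex : exists_optimal_gamma1ParametrizationData) :
    ∀ (W₀ : WeierstrassCurve ℚ) [W₀.IsElliptic] [W₀.IsGloballyMinimal]
      ⦃N : ℕ⦄ [NeZero N] (f : CuspForm (CongruenceSubgroup.Gamma0 N) 2), IsNewformOf W₀ f →
      ¬ 2 ∣ N → (∃ p : ℕ, p.Prime ∧ p ∣ N ∧ cuspCoeff f p = 0) → IsOrdinaryAt W₀ 2 →
      ∀ (L₀ : PeriodPair), IsNeronLatticeOf (W₀.baseChange ℂ) L₀ →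
      ∀ (q : ℚ), q ≠ 0 → (∀ z ∈ periodLattice f, (q : ℂ) * z ∈ L₀.lattice) →
      (∀ z ∈ L₀.lattice, ∃ w ∈ periodLattice f, z = (q : ℂ) * w) →
      ∀ (x₀ : ℚ), HasRationalTwoTorsionX W₀ x₀ → ¬ TwoTorsionRamifiedAtTwo x₀ := by
  intro W₀ _ _ N _ f hW₀ hodd hp hord₀ L₀ hL₀ q hq hin hout x₀ hx₀ hram
  have hS := NsfDoor.stevensAtTwoX1Int hUBD
  have hX := x1OptimalInt_of_print hnf hex
  obtain ⟨p, hp, hpN, hap⟩ := hp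
  have hp2 : p ≠ 2 := by
    rintro rfl
    exact hodd hpN
  -- Stevens' `X₁(N)`-optimal curve of the class, with its INTEGER Manin constant
  obtain ⟨W₁, _i₁, _i₂, L₁, c₁, hW₁, hL₁, hc₁, hint, hin₁, hout₁⟩ := hX W₀ f hW₀
  have hiso : WeierstrassCurve.IsIsogenous W₀ W₁ :=
    IsNewformOf.isIsogenous WeierstrassCurve.isIsogenous_iff_frobeniusTrace_eq_holds hW₀ hW₁
  have hord₁ : IsOrdinaryAt W₁ 2 :=
    Summit.BirchSwinnertonDyer.BirchSwinnertonDyer.Theorems.IsogenyMuShift.isOrdinaryAt_of_isIsogenous hiso hord₀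
  -- Stevens at 2 for `W₁`
  have hno₁ : ¬ ∃ x₁ : ℚ, HasRationalTwoTorsionX W₁ x₁ ∧ TwoTorsionRamifiedAtTwo x₁ := by
    rintro ⟨x₁, hx₁, hram₁⟩
    exact hS W₁ f hW₁ hodd ⟨p, hp, hpN, hap⟩ hord₁ L₁ hL₁ c₁ hc₁ hin₁ hout₁ hint x₁ hx₁ hram₁
  -- the odd Shimura cover transports it to `W₀`
  exact Summit.BirchSwinnertonDyer.BirchSwinnertonDyer.Theorems.DepletionAtTwo.ShimuraCover.not_exists_ramified_of_gamma1Optimal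
    W₀ W₁ hord₀ f hW₀.1 hp hp2 hpN hap hL₀ hL₁ hq hc₁ hin hout hin₁ hout₁ hno₁ ⟨x₀, hx₀, hram⟩

/-- **THE nsf HALF OF THE DOOR, MODULO PRINT: `StarOptBNSF` from the three named facts** — Modularity (`exists_isNewformOf`),
the CES/Stevens optimal `Γ₁(N)`-datum with integer Manin constant (`exists_optimal_gamma1ParametrizationData`), and the unbounded
denominators theorem (`CalegariDimitrovTang2025_unboundedDenominators`).  Every analytic, modular and formal-group step of line `nsf`
(registered skeleton v22 of crux stmt-BirchSwinnertonDyer-27047) is a tree theorem; this is the skeleton's `endState_modulo_print_v22`,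
landed.  CONDITIONAL on the three print facts; it does not close the item by itself; BSD is not proved here.
[cite: CalegariDimitrovTang2025, Thm. 1.0.1] [cite: Stevens1989, §2] [cite: BCDTJAMS2001, Thm. A] -/
theorem starOptBNSF_of_print (hnf : exists_isNewformOf) (hex : exists_optimal_gamma1ParametrizationData)
    (hU : Literature.NumberTheory.Automorphic.CalegariDimitrovTang2025_unboundedDenominators) :
    Summit.BirchSwinnertonDyer.BirchSwinnertonDyer.Theses.EisensteinDepletionAtTwo.StarOptBNSF := by
  intro W _ _ x hord hux htype hN15 hnsf N _ f hW W₀ _ _ hW₀ L₀ hL₀ q hq hin hout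
  have hL := Summit.BirchSwinnertonDyer.BirchSwinnertonDyer.Theorems.EisensteinDepletionAtTwoStarOptBNSFStubLevelDetect.stub_levelDetect
  have hR := Summit.BirchSwinnertonDyer.BirchSwinnertonDyer.Theorems.DepletionAtTwo.NsfReduction.regimeTransport
  have hP := pE0_ord hU hnf hex
  have hiso : WeierstrassCurve.IsIsogenous W W₀ :=
    IsNewformOf.isIsogenous WeierstrassCurve.isIsogenous_iff_frobeniusTrace_eq_holds hW hW₀
  have hord₀ : IsOrdinaryAt W₀ 2 :=
    Summit.BirchSwinnertonDyer.BirchSwinnertonDyer.Theorems.IsogenyMuShift.isOrdinaryAt_of_isIsogenous hiso hord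
  refine hR W x hord hux htype W₀ hiso ?_
  rintro ⟨x₀, hx₀, hram⟩
  obtain ⟨h2N, hlev⟩ := hL W f hW
  have hodd : ¬ 2 ∣ N := h2N hord
  obtain ⟨p, hp, hp2⟩ : ∃ p : ℕ, p.Prime ∧ p ^ 2 ∣ W.conductorNorm ℤ := by
    by_contra hcon
    push Not at hcon
    exact hnsf (Nat.squarefree_iff_prime_squarefree.mpr fun p hp hpp ↦ hcon p hp (by simpa [sq] using hpp))
  obtain ⟨hpN, hap⟩ := hlev p hp hp2
  exact hP W₀ f hW₀ hodd ⟨p, hp, hpN, hap⟩ hord₀ L₀ hL₀ q hq hin hout x₀ hx₀ hram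

end Summit.BirchSwinnertonDyer.BirchSwinnertonDyer.Theorems.DepletionAtTwo.NsfDoorPrint

end
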